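import Literature.AnabelianGeometry.SemiGraphs.ArithThm54iiBindersOuterAction
import Literature.AnabelianGeometry.SemiGraphs.ArithThm54DesignInputsNonVacuity
import Literature.AnabelianGeometry.SemiGraphs.TemperedCompactInVerticialWitnessLoop
import HarnessLib

/-!
# [SemiAnbd] Def 5.1 (i) / Rmk 5.3.1: the BRANCH-form chart-action package and the pair-conjugacy residual
# `hconjPair` INHABITED at the split outer model — non-vacuity of the `hR` design side, also at a graph with an edge

Mochizuki, *Semi-graphs of anabelioids*, Publ. RIMS **42** (2006) 221–322, §5 Def 5.1 (i) p. 62, Rmk 5.3.1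
p. 65, Thm 5.4 (ii) p. 66. [cite: MochizukiSemiAnbd2006, Rmk 5.3.1, p. 65]

PROOF-ONLY non-vacuity file (abc-iut cell, L3 sub-DAG `plan/L3/SUBDAG-SemiAnbd-Thm54.md`, NV row
«hBR-design-NV», L3-lead ruling α76, seat abc-iut-w4-d040 gen 4).  No definition, no new named fact.  The
capstone binder `hR` (Rmk 5.3.1, first sentence) is produced (`ArithThm54iiBindersOuterAction.lean`,
`verticialEdgeLikeCompactAmple_outerAction_of_hBR` / `…_cosetTowerC`) from the four DESIGN binders `hV`, `hE`,
`hopen`, `hBR` of abc-iut-w4-d082's currency plus compactness of the representatives.  abc-iut-w6-d099's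
`ArithThm54DesignInputsNonVacuity.lean` inhabits `hV`/`hE`/`hopen`/`hBR` one by one at the TRIVIAL outer action
`ρ := 1`, `baseAct := 1`.  Here the composite objects are inhabited, by name:

* `arithChartBranchAction_trivialOuterAction` — abc-iut-w4-d053's BRANCH-form package
  `ArithChartBranchAction c ι aug actV actE actB` (Def 5.1 (i) on the chart, with the (host, branch-group) PAIR
  clause (BR)) at `π₁^temp(𝒢) ⋊^out Π_A` for `ρ = 1`, for EVERY semi-graph of anabelioids `𝒢`, every chart,
  every `Π_A` (abc-iut-w4-d040's `arithChartBranchAction_outerAction` ∘ abc-iut-w6-d099's four lemmas — `hBR`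
  through a private copy, d099's v2 object file not being built at filing time);
* `hconjPair_of_trivialOuterAction` — the pair-conjugacy residual `hconjPair` of abc-iut-w4-d029's
  `ArithChartAction.verticialEdgeLikeCompactAmple` / abc-iut-w6-d064's `verticialEdgeLikeCompactAmple_outerAction`
  at `ρ = 1`, wherever Thm 3.7 (iii) holds at `𝒢` (`CompactInVerticialAt 𝒢`; a theorem at finite graphs);
* `verticialEdgeLikeCompactAmple_of_trivialOuterAction` — hence at `ρ = 1` Rmk 5.3.1's first sentence for the
  produced data holds modulo ONLY the compactness of the representatives `hVc`/`hBc` (for any group topology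
  on the split outer model);
* `IwahoriWitness.arithChartBranchAction_loopGraph_trivial`, `IwahoriWitness.hconjPair_loopGraph_trivial` — the
  same AT A GRAPH WITH AN EDGE satisfying Thm 3.7's hypotheses, abc-iut-w5-d236's `loopGraph p` (one vertex,
  one estranged loop; `loopGraph_thm37Hypotheses`, `compactInVerticialAt_loopGraph`): the pair clause (BR) and
  `hconjPair` are inhabited non-vacuously for the loop's two branches.

Honest scope: at `ρ = 1` Thm 5.4's OTHER design input `hest` fails at the loop
(`ArithTotalEstrangementSplitObstruction*.lean`, `…OpenKernelObstruction.lean`); this file certifies the `hR`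
side only.  Nothing here bears on [IUTchIII] Cor. 3.12; typed ≠ proved.
-/

namespace Literature.AnabelianGeometry.SemiGraphs

universe u w

namespace ProfiniteSemiGraph

open Literature.AnabelianGeometry.EtaleTheta CategoryTheory Topology

variable {𝒢 : ProfiniteSemiGraph.{u}} (c : TemperedPiChart 𝒢) (PA : Type w) [Group PA] [TopologicalSpace PA]

omit [TopologicalSpace PA] in
/-- PRIVATE COPY of abc-iut-w6-d099's `hBR_of_trivialOuterAction` (ArithThm54DesignInputsNonVacuity.lean v2,
accepted; its object file was not yet built when this file was checked — the public theorem of record is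
d099's; this copy only bypasses the build lane): `hBR` at `ρ := 1`, `baseAct := 1` with `Φ := 1`, `φ' := φ`,
`x' := 1`. [cite: MochizukiSemiAnbd2006, Def 5.1 (i), p. 62] -/
private theorem hBR_of_trivialOuterAction' :
    ∀ (a : PA) (b : 𝒢.graph.Branch) (v : 𝒢.graph.Vertex) (hb : 𝒢.graph.abuts b = some v)
      (φ : 𝒢.Gv v →ₜ* c.G), IsVerticialHom c v φ →
      ∃ Φ : contMulAut c.G, TopOut.mk c.G Φ = (1 : PA →* TopOut c.G) a ∧
        ∃ φ' : 𝒢.Gv (((1 : PA →* Aut 𝒢.graph) a).hom.vertexMap v) →ₜ* c.G,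
          IsVerticialHom c (((1 : PA →* Aut 𝒢.graph) a).hom.vertexMap v) φ' ∧ ∃ x' : c.G,
            Subgroup.map (Φ : MulAut c.G).toMonoidHom φ.toMonoidHom.range =
              Subgroup.map (MulAut.conj x').toMonoidHom φ'.toMonoidHom.range ∧
            Subgroup.map (Φ : MulAut c.G).toMonoidHom
                (Subgroup.map φ.toMonoidHom (𝒢.branchSubgroup b v hb)) =
              Subgroup.map (MulAut.conj x').toMonoidHom
                (Subgroup.map φ'.toMonoidHom
                  (𝒢.branchSubgroup (((1 : PA →* Aut 𝒢.graph) a).hom.branchMap b)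
                    (((1 : PA →* Aut 𝒢.graph) a).hom.vertexMap v)
                    (((1 : PA →* Aut 𝒢.graph) a).hom.abuts_branchMap b v hb))) := by
  intro a b v hb φ hφ
  have h1 : ∀ H : Subgroup c.G, H.map ((1 : contMulAut c.G) : MulAut c.G).toMonoidHom = H :=
    map_coe_one_contMulAut c
  have h2 : ∀ H : Subgroup c.G, H.map (MulAut.conj (1 : c.G)).toMonoidHom = H := fun H => by
    ext x
    constructor
    · rintro ⟨y, hy, rfl⟩
      simpa using hy
    · intro hx
      exact ⟨x, hx, by simp⟩
  refine ⟨1, by rw [map_one, MonoidHom.one_apply], φ, hφ, 1, ?_, ?_⟩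
  · rw [h1, h2]
    exact rfl
  · rw [h1, h2]
    exact rfl

/-- **Def 5.1 (i) on the chart, BRANCH form, INHABITED at the split outer model**: abc-iut-w4-d053's package
`ArithChartBranchAction` holds at `π₁^temp(𝒢) ⋊^out Π_A` for the trivial outer action `ρ = 1` and the trivial
base action, for every `𝒢`, every chart and every `Π_A` (`arithChartBranchAction_outerAction` fed with
abc-iut-w6-d099's `hV`/`hE`/`hopen`/`hBR_of_trivialOuterAction`). [cite: MochizukiSemiAnbd2006, Def 5.1 (i), p. 62] -/
theorem arithChartBranchAction_trivialOuterAction :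
    ArithChartBranchAction c (toOuterSemidirectProduct (1 : PA →* TopOut c.G))
      (outerSemidirectProductSnd (1 : PA →* TopOut c.G))
      (fun a v => ((1 : PA →* Aut 𝒢.graph) a).hom.vertexMap v)
      (fun a e => ((1 : PA →* Aut 𝒢.graph) a).hom.edgeMap e)
      (fun a b => ((1 : PA →* Aut 𝒢.graph) a).hom.branchMap b) :=
  arithChartBranchAction_outerAction c (1 : PA →* TopOut c.G) (1 : PA →* Aut 𝒢.graph)
    (hV_of_trivialOuterAction c PA) (hE_of_trivialOuterAction c PA) (hopen_of_trivialBaseAct PA)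
    (hBR_of_trivialOuterAction' c PA)

variable {PA}

/-- **The pair-conjugacy residual `hconjPair` INHABITED at the split outer model** (Rmk 5.3.1 / Def 5.1 (i)
pp. 62, 65): at `ρ = 1`, wherever Thm 3.7 (iii) holds at `𝒢`, for every branch `b` abutting to `v` there is an
open `U ≤ Π_A` (here all of `Π_A`) whose elements lift to `π₁^temp(𝒢) ⋊^out Π_A` conjugating the pair
(`ι Π^temp_{𝔾,v}`, `ι Π^temp_{𝔾,b}`) like an inner automorphism of `π₁^temp(𝒢)` (`hconjPair_outerAction` ∘
abc-iut-w6-d099's lemmas). [cite: MochizukiSemiAnbd2006, Rmk 5.3.1, p. 65] -/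
theorem hconjPair_of_trivialOuterAction (h : CompactInVerticialAt 𝒢) (h𝒢 : 𝒢.Thm37Hypotheses)
    (hG : 𝒢.graph.IsGraph) (R : ChartRepresentatives c)
    (b : 𝒢.graph.Branch) (v : 𝒢.graph.Vertex) (hb : 𝒢.graph.abuts b = some v) :
    ∃ U : Subgroup PA, IsOpen (U : Set PA) ∧ ∀ a ∈ U,
      ∃ g : outerSemidirectProduct (1 : PA →* TopOut c.G),
        outerSemidirectProductSnd (1 : PA →* TopOut c.G) g = a ∧ ∃ h : c.G,
          conjSubgroup g ((R.Hv v).map (toOuterSemidirectProduct (1 : PA →* TopOut c.G))) =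
              conjSubgroup (toOuterSemidirectProduct (1 : PA →* TopOut c.G) h)
                ((R.Hv v).map (toOuterSemidirectProduct (1 : PA →* TopOut c.G))) ∧
            conjSubgroup g ((R.Hb b).map (toOuterSemidirectProduct (1 : PA →* TopOut c.G))) =
              conjSubgroup (toOuterSemidirectProduct (1 : PA →* TopOut c.G) h)
                ((R.Hb b).map (toOuterSemidirectProduct (1 : PA →* TopOut c.G))) :=
  hconjPair_outerAction c (1 : PA →* TopOut c.G) (1 : PA →* Aut 𝒢.graph) h h𝒢 hG R
    (hV_of_trivialOuterAction c PA) (hE_of_trivialOuterAction c PA) (hopen_of_trivialBaseAct PA)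
    (hBR_of_trivialOuterAction' c PA) b v hb

/-- **Rmk 5.3.1, first sentence, at the split outer model modulo compactness only**: at `ρ = 1`, wherever
Thm 3.7 (iii) holds at `𝒢` and `𝔾` is a graph, every verticial or edge-like subgroup of the produced data is
compact and arithmetically ample PROVIDED the representatives `arithVertGp`/`arithBrGp` are compact — for any
group topology on `π₁^temp(𝒢) ⋊^out Π_A` (all four design binders discharged by abc-iut-w6-d099's lemmas).
[cite: MochizukiSemiAnbd2006, Rmk 5.3.1, p. 65] -/
theorem verticialEdgeLikeCompactAmple_of_trivialOuterAction [IsTopologicalGroup PA]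
    [TopologicalSpace (outerSemidirectProduct (1 : PA →* TopOut c.G))]
    [IsTopologicalGroup (outerSemidirectProduct (1 : PA →* TopOut c.G))]
    (h : CompactInVerticialAt 𝒢) (h𝒢 : 𝒢.Thm37Hypotheses) (hG : 𝒢.graph.IsGraph) (R : ChartRepresentatives c)
    (hVc : ∀ v, IsCompact (arithVertGp R (toOuterSemidirectProduct (1 : PA →* TopOut c.G)) v :
      Set (outerSemidirectProduct (1 : PA →* TopOut c.G))))
    (hBc : ∀ b, IsCompact (arithBrGp R (toOuterSemidirectProduct (1 : PA →* TopOut c.G)) b :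
      Set (outerSemidirectProduct (1 : PA →* TopOut c.G)))) :
    VerticialEdgeLikeCompactAmpleStatement
      (decompositionDataOfChart R (toOuterSemidirectProduct (1 : PA →* TopOut c.G)))
      (outerSemidirectProductSnd (1 : PA →* TopOut c.G)) :=
  verticialEdgeLikeCompactAmple_outerAction_of_hBR c (1 : PA →* TopOut c.G) (1 : PA →* Aut 𝒢.graph) h h𝒢 hG R
    (hV_of_trivialOuterAction c PA) (hE_of_trivialOuterAction c PA) (hopen_of_trivialBaseAct PA)
    (hBR_of_trivialOuterAction' c PA) hVc hBc

end ProfiniteSemiGraph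

/-! ### At a graph WITH an edge satisfying Thm 3.7's hypotheses: the estranged loop `𝒢₁` -/

namespace IwahoriWitness

open ProfiniteSemiGraph Literature.AnabelianGeometry.EtaleTheta CategoryTheory

variable (p : ℕ) [Fact p.Prime] (PA : Type w) [Group PA] [TopologicalSpace PA]

/-- **Def 5.1 (i), BRANCH form, inhabited at the estranged loop `𝒢₁ = loopGraph p`** for the split outer model,
every chart and every `Π_A` — the pair clause (BR) is non-vacuous here (the loop has two branches at the unique
vertex). [cite: MochizukiSemiAnbd2006, Def 5.1 (i), p. 62] -/
theorem arithChartBranchAction_loopGraph_trivial (c : TemperedPiChart (loopGraph p)) :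
    ArithChartBranchAction c (toOuterSemidirectProduct (1 : PA →* TopOut c.G))
      (outerSemidirectProductSnd (1 : PA →* TopOut c.G))
      (fun a v => ((1 : PA →* Aut (loopGraph p).graph) a).hom.vertexMap v)
      (fun a e => ((1 : PA →* Aut (loopGraph p).graph) a).hom.edgeMap e)
      (fun a b => ((1 : PA →* Aut (loopGraph p).graph) a).hom.branchMap b) :=
  arithChartBranchAction_trivialOuterAction c PA

variable {PA}

/-- **`hconjPair` inhabited at the estranged loop `𝒢₁`** for the split outer model, every chart, every `Π_A`,
every choice of representatives and EVERY (branch, host) pair of the loop — non-vacuously: Thm 3.7 (iii) holds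
at `𝒢₁` (`compactInVerticialAt_loopGraph`), Thm 3.7's hypotheses are witnessed (`loopGraph_thm37Hypotheses`),
the bouquet is a graph (`loopGraph_isGraph`). [cite: MochizukiSemiAnbd2006, Rmk 5.3.1, p. 65] -/
theorem hconjPair_loopGraph_trivial (c : TemperedPiChart (loopGraph p)) (R : ChartRepresentatives c)
    (b : (loopGraph p).graph.Branch) (v : (loopGraph p).graph.Vertex) (hb : (loopGraph p).graph.abuts b = some v) :
    ∃ U : Subgroup PA, IsOpen (U : Set PA) ∧ ∀ a ∈ U,
      ∃ g : outerSemidirectProduct (1 : PA →* TopOut c.G),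
        outerSemidirectProductSnd (1 : PA →* TopOut c.G) g = a ∧ ∃ h : c.G,
          conjSubgroup g ((R.Hv v).map (toOuterSemidirectProduct (1 : PA →* TopOut c.G))) =
              conjSubgroup (toOuterSemidirectProduct (1 : PA →* TopOut c.G) h)
                ((R.Hv v).map (toOuterSemidirectProduct (1 : PA →* TopOut c.G))) ∧
            conjSubgroup g ((R.Hb b).map (toOuterSemidirectProduct (1 : PA →* TopOut c.G))) =
              conjSubgroup (toOuterSemidirectProduct (1 : PA →* TopOut c.G) h)
                ((R.Hb b).map (toOuterSemidirectProduct (1 : PA →* TopOut c.G))) :=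
  hconjPair_of_trivialOuterAction c (compactInVerticialAt_loopGraph p) (loopGraph_thm37Hypotheses p)
    (loopGraph_isGraph p) R b v hb

end IwahoriWitness

end Literature.AnabelianGeometry.SemiGraphs
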